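import Summits.Ventures.CertifiedManyBodySolver.Transport.MPSPrimalSpinChain

/-!
# Row predicate for the lane-B `relax = mps(N, D, A)` by-value node of the spin chain (model `heisenberg(J)`):
# the named node shape with rational slots, its cells BY NAME, and the rational side conditions of the transport

HONEST FRAMING: first certified bounds; not a superconductivity verdict; every number certified or labelled float.

WHAT THIS FILE IS (speedrun cell sr-mbsolver, LIT team lit-1 gen-8; LEAD D-19 r118 (c) default track "THEOREM B"). The tree
proves the transport `Transport.mps_primal_energyDensity_ge` (`Transport/MPSPrimalSpinChain.lean`): the finite statement a
lane-B `relax = mps(N, D, A)` Heisenberg certificate certifies (FORMAT-ltisdp §1/§4.7, both readers accepting; KSDN's coarse-grained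
locally-translation-invariant relaxation, arXiv:2212.03014 §2.5 eq. (TNfullRelax5)) implies `E ≤ heisenbergEnergyDensity n 1 J`.
This file NAMES that hypothesis shape as a ROW PREDICATE with rational slots,
  `MPSSpinChainNode n J N D A qb B lo`
(spin `n/2`; coupling `J`; window `N` = the `n` of `mps(n, D, A)`; bond dimension `D`; the tensor `A : Fin (n+1) → Matrix (Fin D) (Fin D) ℚ`
= `meta.A` VERBATIM; the bond charges `qb : Fin D → ℤ` = `meta.bond_charges`; the a-priori bounds `B : ℕ → ℚ`, `B m` = the bound of the
`ω_m` variables = `max(1, meta.omega_entry_bounds[m])`; the slot `lo` = `claimed.bound`), so that a `Certificates/` instance of an `mps`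
row is `@[conjecture] def cert_… : Prop := MPSSpinChainNode 1 1 8 4 A qb B lo` plus ONE LINE `cert_….energyDensity_ge …`, and a
referee's by-name audit compares the predicate NAME and its literal data with the problem file. The binder list of the predicate is
VERBATIM the `hclaim` of `Transport.lti_claim_of_mps_claim` with the rational data cast (`castTensor A`, `((B m : ℚ) : ℝ)`,
`((lo : ℚ) : ℝ)`) and `N` for `m' + 2`.

It proves the cells BY NAME — `MPSSpinChainNode.energyDensity_ge` (thermodynamic limit), `….ringEnergy_ge` (every ring `L ≥ N+1`),
`….ltiClaim` (the solver-free edge to the unbundled `lti(N)` node of `Transport/LTIPrimalSpinChain.lean`), `….mono` — under the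
two RATIONAL side conditions of the transport, stated so that an instance discharges them by `decide` / `norm_num` on the file's
data: charge covariance `A^s_{ab} ≠ 0 ⇒ qb b = qb a + (n − 2s)` (FORMAT §4.12 "CHECKED at generation") and
`frobSqQ (transferOpQ A ^ (m−2)) ≤ (B m)²`, `0 ≤ B m` (FORMAT §4.7: `B_k = ceil_{2^20} √‖T^k‖_F²`, `T = Σ_s A^s ⊗ A^s`; here
`transferOpQ A = Σ_s A^s ⊗ₖ A^s` over `ℚ` and `frobSqQ M = Σ_{ij} M_{ij}²`, bridged to the complex `transferOp` / `frobSq` of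
`Literature/…/MPSTransferMatrix` by `frobSq_transferOp_castTensor_pow`).

NOTHING IS ASSERTED HERE: the node is a `def … : Prop` taken as a hypothesis; nodes are instantiated only under `Certificates/` from
certificate files. No `sorry`, no new axiom, no named fact. [cite: KullEtAl2024, §2.3–2.5, §4.2] [cite: Tasaki2020, §2.1, §2.4–2.5]
-/

noncomputable section

open Matrix Complex Filter Topology
open scoped ComplexOrder Kronecker BigOperators
open Literature.Probability.LatticeModels
open Literature.MathematicalPhysics.QuantumLattice
open Literature.MathematicalPhysics.QuantumLattice.MPSCoarseGraining
open Literature.Computability.QuantumComplexity (traceLeft traceRight)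
open Summit.Ventures.CertifiedManyBodySolver.Transport

namespace Summit.Ventures.CertifiedManyBodySolver

/-! ## §A  Rational data of an `mps` problem file, read into the tree's objects -/

section Data

/-- The FORMAT-ltisdp site charge of the `heisenberg` model form, `q(s) = 2Sᶻ(s) = n − 2s` for a spin-`n/2` site state
`s ∈ {0, …, n}` (`s = 0` the top state; `d = 2`: `q(up) = +1`, `q(down) = −1`; FORMAT §4.1 "charges q(s) = (+1), (−1) [= 2S^z]").
[cite: KullEtAl2024, §3.3] -/
def twoSzCharge (n : ℕ) (s : Fin (n + 1)) : ℤ := (n : ℤ) - 2 * ((s : ℕ) : ℤ)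

/-- Unfolding `twoSzCharge`. -/
@[simp] theorem twoSzCharge_apply (n : ℕ) (s : Fin (n + 1)) : twoSzCharge n s = (n : ℤ) - 2 * ((s : ℕ) : ℤ) := rfl

variable {q D : ℕ}

/-- A rational MPS tensor `A = (A^s)_s` (`meta.A`: exact dyadic rationals, `d` matrices `D × D`) read as a complex tensor.
[cite: KullEtAl2024, §2.5] -/
def castTensor (A : Fin q → Matrix (Fin D) (Fin D) ℚ) : Fin q → Matrix (Fin D) (Fin D) ℂ :=
  fun s => (A s).map ((↑) : ℚ → ℂ)

/-- Entries of `castTensor A`. -/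
@[simp] theorem castTensor_apply (A : Fin q → Matrix (Fin D) (Fin D) ℚ) (s : Fin q) (a b : Fin D) :
    castTensor A s a b = ((A s a b : ℚ) : ℂ) := rfl

/-- A cast rational tensor is real: `star (A^s_{ab}) = A^s_{ab}`. -/
theorem star_castTensor_apply (A : Fin q → Matrix (Fin D) (Fin D) ℚ) (s : Fin q) (a b : Fin D) :
    star (castTensor A s a b) = castTensor A s a b := by
  rw [castTensor_apply, ← Complex.ofReal_ratCast]
  exact Complex.conj_ofReal _

/-- Nonzero pattern of the cast tensor = nonzero pattern of the rational tensor. -/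
theorem castTensor_apply_ne_zero_iff (A : Fin q → Matrix (Fin D) (Fin D) ℚ) (s : Fin q) (a b : Fin D) :
    castTensor A s a b ≠ 0 ↔ A s a b ≠ 0 := by
  rw [castTensor_apply, Ne, Rat.cast_eq_zero]

/-- FORMAT-ltisdp's transfer matrix over `ℚ`: `T = Σ_s A^s ⊗ A^s`, index `((a,a'),(b,b')) ↦ A^s_{ab} A^s_{a'b'}` (§4.7 "T = Σ_s A^s ⊗ A^s
with index (a·D+a', b·D+b') ↦ A^s_{ab}A^s_{a'b'}"). [cite: KullEtAl2024, §2.5] -/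
def transferOpQ (A : Fin q → Matrix (Fin D) (Fin D) ℚ) : Matrix (Fin D × Fin D) (Fin D × Fin D) ℚ :=
  ∑ s, A s ⊗ₖ A s

/-- FORMAT-ltisdp's "exact sum of squares" `‖M‖_F² = Σ_{ij} M_{ij}²` of a rational matrix (§4.7). [folklore] -/
def frobSqQ {m m' : Type*} [Fintype m] [Fintype m'] (M : Matrix m m' ℚ) : ℚ := ∑ i, ∑ j, M i j ^ 2

/-- The complex transfer matrix of the cast tensor is the cast of the rational one: `T(castTensor A) = (transferOpQ A : ℂ)`.
[cite: KullEtAl2024, §2.5] -/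
theorem transferOp_castTensor (A : Fin q → Matrix (Fin D) (Fin D) ℚ) :
    MPSCoarseGraining.transferOp (castTensor A) = (transferOpQ A).map ((↑) : ℚ → ℂ) := by
  ext ⟨a, a'⟩ ⟨c, c'⟩
  rw [MPSCoarseGraining.transferOp_apply, Matrix.map_apply, transferOpQ, Matrix.sum_apply, Rat.cast_sum]
  refine Finset.sum_congr rfl fun s _ => ?_
  rw [star_castTensor_apply, castTensor_apply, castTensor_apply, Matrix.kroneckerMap_apply, Rat.cast_mul]

/-- Powers commute with the cast: `T(castTensor A)^k = (transferOpQ A ^ k : ℂ)`. [folklore] -/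
theorem transferOp_castTensor_pow (A : Fin q → Matrix (Fin D) (Fin D) ℚ) (k : ℕ) :
    MPSCoarseGraining.transferOp (castTensor A) ^ k = (transferOpQ A ^ k).map ((↑) : ℚ → ℂ) := by
  rw [transferOp_castTensor]
  exact (map_pow (Rat.castHom ℂ).mapMatrix (transferOpQ A) k).symm

/-- The squared Frobenius norm of a cast rational matrix is the cast of the exact sum of squares. [folklore] -/
theorem frobSq_map_ratCast {m m' : Type*} [Fintype m] [Fintype m'] (M : Matrix m m' ℚ) :
    frobSq (M.map ((↑) : ℚ → ℂ)) = ((frobSqQ M : ℚ) : ℝ) := by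
  rw [frobSq, frobSqQ, Rat.cast_sum]
  refine Finset.sum_congr rfl fun i _ => ?_
  rw [Rat.cast_sum]
  refine Finset.sum_congr rfl fun j _ => ?_
  rw [Matrix.map_apply, ← Complex.ofReal_ratCast, Complex.norm_real, Real.norm_eq_abs, sq_abs, Rat.cast_pow]

/-- **The a-priori-bound side condition in exact rational form**: `‖T(castTensor A)^k‖_F² = frobSqQ (transferOpQ A ^ k)`.
[cite: KullEtAl2024, §2.5] -/
theorem frobSq_transferOp_castTensor_pow (A : Fin q → Matrix (Fin D) (Fin D) ℚ) (k : ℕ) :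
    frobSq (MPSCoarseGraining.transferOp (castTensor A) ^ k) = ((frobSqQ (transferOpQ A ^ k) : ℚ) : ℝ) := by
  rw [transferOp_castTensor_pow, frobSq_map_ratCast]

end Data

/-! ## §B  The node predicate (window of `N` sites, bond dimension `D`, model `heisenberg(J)`, spin `n/2`) -/

section Nodes

/-- **Lane-B `relax = mps(N, D, A)` node, model `heisenberg(J)`** (the `hclaim` of `Transport.lti_claim_of_mps_claim` /
`Transport.mps_primal_energyDensity_ge` with rational data; FORMAT-ltisdp §1, §4.7): for all variables `ρ₃ : Op (Fin 3) (n+1)` and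
`ω m` (`4 ≤ m ≤ N`, indexed `(s_L, (a,b), s_R)`), IF `ρ₃ ⪰ 0`, `tr ρ₃ = 1`, LTI₃ `tr_L ρ₃ = tr_R ρ₃`, the `2Sᶻ`-sector zeros of `ρ₃`
(`Σ s_x` form), real entries, `|ρ₃| ≤ 1`; row E4L `tr_{s_L} ω₄ = (W₂ ⊗ 𝟙) ρ₃ (W₂ ⊗ 𝟙)ᴴ` (`ρ₃` read as (first two sites, last site),
`W₂ = cgMap (castTensor A) 2`), row E4R `tr_{s_R} ω₄ = (𝟙 ⊗ W₂) ρ₃ (𝟙 ⊗ W₂)ᴴ` (read as (first site, last two sites)), rows E_mL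
`tr_{s_L} ω_m = (L ⊗ 𝟙) ω_{m−1} (L ⊗ 𝟙)ᴴ` and E_mR `tr_{s_R} ω_m = (𝟙 ⊗ R) ω_{m−1} (𝟙 ⊗ R)ᴴ` for `5 ≤ m ≤ N` (`L = leftMap`, `R = rightMap`
of `castTensor A`); `ω_m ⪰ 0`, sector zeros of `ω_m` for the tags `q(s_L) + (qb b − qb a) + q(s_R)` (`cgTag (twoSzCharge n) qb`, FORMAT §4.3),
real entries, `|ω_m| ≤ B m` (`4 ≤ m ≤ N`) — THEN `lo ≤ Re tr((J 𝐒₀·𝐒₁) ρ₃)`. By-name audit token: predicate NAME + `(n, J, N, D)` + the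
tables `A` (= `meta.A`), `qb` (= `meta.bond_charges`), `B m` (= `max(1, meta.omega_entry_bounds[m])`), `lo` (= `claimed.bound`).
[cite: KullEtAl2024, §2.5 eq. (TNfullRelax5), §4.2 eq. (relaxLocTIn)] -/
def MPSSpinChainNode (n : ℕ) (J : ℝ) (N D : ℕ) (A : Fin (n + 1) → Matrix (Fin D) (Fin D) ℚ) (qb : Fin D → ℤ)
    (B : ℕ → ℚ) (lo : ℚ) : Prop :=
  ∀ (ρ₃ : Op (Fin 3) (n + 1))
    (ω : ℕ → Matrix (Fin (n + 1) × ((Fin D × Fin D) × Fin (n + 1))) (Fin (n + 1) × ((Fin D × Fin D) × Fin (n + 1))) ℂ),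
    ρ₃.PosSemidef → ρ₃.trace = 1 →
    spinPartialTrace (Fin.succEmb 2) ρ₃ = spinPartialTrace Fin.castSuccEmb ρ₃ →
    (∀ t s : TensorIndex (Fin 3) (n + 1), (∑ x, (t x : ℕ)) ≠ (∑ x, (s x : ℕ)) → ρ₃ t s = 0) →
    (∀ t s : TensorIndex (Fin 3) (n + 1), starRingEnd ℂ (ρ₃ t s) = ρ₃ t s) →
    (∀ t s : TensorIndex (Fin 3) (n + 1), ‖ρ₃ t s‖ ≤ 1) →
    traceLeft (ω 4) = (cgMap (castTensor A) 2 ⊗ₖ (1 : Matrix (Fin (n + 1)) (Fin (n + 1)) ℂ)) *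
        ρ₃.submatrix ((Equiv.prodComm _ _).trans (Fin.snocEquiv fun _ => Fin (n + 1)))
          ((Equiv.prodComm _ _).trans (Fin.snocEquiv fun _ => Fin (n + 1))) *
      (cgMap (castTensor A) 2 ⊗ₖ (1 : Matrix (Fin (n + 1)) (Fin (n + 1)) ℂ))ᴴ →
    traceRight ((ω 4).submatrix (Equiv.prodAssoc _ _ _) (Equiv.prodAssoc _ _ _)) =
      ((1 : Matrix (Fin (n + 1)) (Fin (n + 1)) ℂ) ⊗ₖ cgMap (castTensor A) 2) *
        ρ₃.submatrix (Fin.consEquiv fun _ => Fin (n + 1)) (Fin.consEquiv fun _ => Fin (n + 1)) *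
      ((1 : Matrix (Fin (n + 1)) (Fin (n + 1)) ℂ) ⊗ₖ cgMap (castTensor A) 2)ᴴ →
    (∀ k, k + 5 ≤ N → traceLeft (ω (k + 5)) =
      (leftMap (castTensor A) ⊗ₖ (1 : Matrix (Fin (n + 1)) (Fin (n + 1)) ℂ)) *
        (ω (k + 4)).submatrix (Equiv.prodAssoc _ _ _) (Equiv.prodAssoc _ _ _) *
      (leftMap (castTensor A) ⊗ₖ (1 : Matrix (Fin (n + 1)) (Fin (n + 1)) ℂ))ᴴ) →
    (∀ k, k + 5 ≤ N → traceRight ((ω (k + 5)).submatrix (Equiv.prodAssoc _ _ _) (Equiv.prodAssoc _ _ _)) =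
      ((1 : Matrix (Fin (n + 1)) (Fin (n + 1)) ℂ) ⊗ₖ rightMap (castTensor A)) * ω (k + 4) *
      ((1 : Matrix (Fin (n + 1)) (Fin (n + 1)) ℂ) ⊗ₖ rightMap (castTensor A))ᴴ) →
    (∀ k, k + 4 ≤ N → (ω (k + 4)).PosSemidef) →
    (∀ k, k + 4 ≤ N → ∀ i j, cgTag (twoSzCharge n) qb i ≠ cgTag (twoSzCharge n) qb j → ω (k + 4) i j = 0) →
    (∀ k, k + 4 ≤ N → ∀ i j, starRingEnd ℂ (ω (k + 4) i j) = ω (k + 4) i j) →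
    (∀ k, k + 4 ≤ N → ∀ i j, ‖ω (k + 4) i j‖ ≤ ((B (k + 4) : ℚ) : ℝ)) →
    ((lo : ℚ) : ℝ) ≤ ((((J : ℂ) • spinDot n (0 : Fin 3) 1) * ρ₃).trace).re

end Nodes

/-! ## §C  Edges and cells BY NAME -/

section Cells

variable {n N D : ℕ} {J : ℝ} {A : Fin (n + 1) → Matrix (Fin D) (Fin D) ℚ} {qb : Fin D → ℤ} {B : ℕ → ℚ} {lo lo' : ℚ}

/-- A node survives a SMALLER slot `lo' ≤ lo`. -/
theorem MPSSpinChainNode.mono (h : MPSSpinChainNode n J N D A qb B lo) (hlo : lo' ≤ lo) :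
    MPSSpinChainNode n J N D A qb B lo' :=
  fun ρ₃ ω h1 h2 h3 h4 h5 h6 h7 h8 h9 h10 h11 h12 h13 h14 =>
    le_trans (by exact_mod_cast hlo) (h ρ₃ ω h1 h2 h3 h4 h5 h6 h7 h8 h9 h10 h11 h12 h13 h14)

/-- The complex-side bound hypothesis of the transport from the RATIONAL check `frobSqQ (transferOpQ A ^ (m−2)) ≤ (B m)²`, `0 ≤ B m`. -/
theorem mpsBounds_of_rat (hB : ∀ k, k + 4 ≤ N → 0 ≤ B (k + 4) ∧ frobSqQ (transferOpQ A ^ (k + 2)) ≤ B (k + 4) ^ 2) :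
    ∀ k, k + 4 ≤ N → 0 ≤ ((B (k + 4) : ℚ) : ℝ) ∧
      frobSq (MPSCoarseGraining.transferOp (castTensor A) ^ (k + 2)) ≤ ((B (k + 4) : ℚ) : ℝ) ^ 2 := by
  intro k hk
  refine ⟨by exact_mod_cast (hB k hk).1, ?_⟩
  rw [frobSq_transferOp_castTensor_pow]
  exact_mod_cast (hB k hk).2

/-- Charge covariance of the cast tensor from the RATIONAL check `A^s_{ab} ≠ 0 ⇒ qb b = qb a + (n − 2s)`. -/
theorem mpsCov_of_rat (hAcov : ∀ s a b, A s a b ≠ 0 → qb b = qb a + twoSzCharge n s) :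
    ∀ s a b, castTensor A s a b ≠ 0 → qb b = qb a + ((n : ℤ) - 2 * ((s : ℕ) : ℤ)) :=
  fun s a b h => hAcov s a b ((castTensor_apply_ne_zero_iff A s a b).1 h)

/-- **Edge `mps(N, D, A)` node ⇒ unbundled `lti(N)` node** (`N = m' + 2 ≥ 4`): under the rational side conditions, the `mps`
node implies the `hclaim` of `Transport.lti_primal_ringEnergy_ge` / `lti_primal_energyDensity_ge` for the `N`-site window with
`E = lo`. Solver-free (the feasible point of KSDN §4.2). [cite: KullEtAl2024, §4.2] -/
theorem MPSSpinChainNode.ltiClaim {m' : ℕ} (h : MPSSpinChainNode n J (m' + 2) D A qb B lo) (hm' : 2 ≤ m')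
    (hAcov : ∀ s a b, A s a b ≠ 0 → qb b = qb a + twoSzCharge n s)
    (hB : ∀ k, k + 4 ≤ m' + 2 → 0 ≤ B (k + 4) ∧ frobSqQ (transferOpQ A ^ (k + 2)) ≤ B (k + 4) ^ 2)
    (ρ : Op (Fin (m' + 2)) (n + 1)) (hpsd : ρ.PosSemidef) (htr : ρ.trace = 1)
    (hLTI : spinPartialTrace (Fin.succEmb (m' + 1)) ρ = spinPartialTrace Fin.castSuccEmb ρ)
    (hsec : ∀ t s : TensorIndex (Fin (m' + 2)) (n + 1), (∑ x, (t x : ℕ)) ≠ (∑ x, (s x : ℕ)) → ρ t s = 0)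
    (hreal : ∀ t s : TensorIndex (Fin (m' + 2)) (n + 1), starRingEnd ℂ (ρ t s) = ρ t s)
    (hbd : ∀ t s : TensorIndex (Fin (m' + 2)) (n + 1), ‖ρ t s‖ ≤ 1) :
    ((lo : ℚ) : ℝ) ≤ ((((J : ℂ) • spinDot n (0 : Fin (m' + 2)) 1) * ρ).trace).re :=
  lti_claim_of_mps_claim n m' hm' J (castTensor A) (star_castTensor_apply A) qb (mpsCov_of_rat hAcov)
    (fun m => ((B m : ℚ) : ℝ)) (mpsBounds_of_rat hB) h ρ hpsd htr hLTI hsec hreal hbd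

/-- **Cell BY NAME, every ring**: `mps` node for the `N ≥ 4`-site window ⇒ `lo · L ≤ E₀(H_L)` for every ring `ℤ/Lℤ`, `L ≥ N + 1`
(`H_L = J Σ 𝐒_x·𝐒_{x+1}`), under the rational side conditions. [cite: KullEtAl2024, §2.5, §4.2, §6.2] [cite: Tasaki2020, §2.4–2.5] -/
theorem MPSSpinChainNode.ringEnergy_ge (h : MPSSpinChainNode n J N D A qb B lo) (hN : 4 ≤ N)
    (hAcov : ∀ s a b, A s a b ≠ 0 → qb b = qb a + twoSzCharge n s)
    (hB : ∀ k, k + 4 ≤ N → 0 ≤ B (k + 4) ∧ frobSqQ (transferOpQ A ^ (k + 2)) ≤ B (k + 4) ^ 2)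
    {L : ℕ} [NeZero L] (hL : N + 1 ≤ L) :
    ((lo : ℚ) : ℝ) * L ≤ (heisenbergHamiltonian n (torusGraph 1 L) J).groundEnergy := by
  obtain ⟨m', rfl⟩ : ∃ m', N = m' + 2 := ⟨N - 2, by omega⟩
  exact lti_primal_ringEnergy_ge n m' J (by omega) fun ρ h1 h2 h3 h4 h5 h6 =>
    h.ltiClaim (by omega) hAcov hB ρ h1 h2 h3 h4 h5 h6

/-- **Cell BY NAME, thermodynamic limit**: `mps` node for the `N ≥ 4`-site window and `J ≥ 0` ⇒ `lo ≤ heisenbergEnergyDensity n 1 J`,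
under the rational side conditions (charge covariance of `A`; `frobSqQ (transferOpQ A ^ (m−2)) ≤ (B m)²`, `0 ≤ B m`).
[cite: KullEtAl2024, §2.5, §4.2, §6.2] [cite: Ruelle1969, §2.2] -/
theorem MPSSpinChainNode.energyDensity_ge (h : MPSSpinChainNode n J N D A qb B lo) (hN : 4 ≤ N) (hJ : 0 ≤ J)
    (hAcov : ∀ s a b, A s a b ≠ 0 → qb b = qb a + twoSzCharge n s)
    (hB : ∀ k, k + 4 ≤ N → 0 ≤ B (k + 4) ∧ frobSqQ (transferOpQ A ^ (k + 2)) ≤ B (k + 4) ^ 2) :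
    ((lo : ℚ) : ℝ) ≤ heisenbergEnergyDensity n 1 J := by
  obtain ⟨m', rfl⟩ : ∃ m', N = m' + 2 := ⟨N - 2, by omega⟩
  exact lti_primal_energyDensity_ge n m' hJ fun ρ h1 h2 h3 h4 h5 h6 =>
    h.ltiClaim (by omega) hAcov hB ρ h1 h2 h3 h4 h5 h6

end Cells

end Summit.Ventures.CertifiedManyBodySolver
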